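import Summits.KontsevichZagierPeriods.KontsevichZagierPeriods.Theses.HyperbolicBloch
import Literature.NumberTheory.Transcendental.KZCubicalCalculus
import Literature.NumberTheory.Transcendental.KZVolumeConjectureProofs

/-!
# Sketch — crux OffTetraSectorKernel (stmt-KontsevichZagierPeriods-10557), ideator 3, round 1

First lemmas of the crux idea cards `value-one-cube-orbit` and `odd-simplex-ladder`.
Everything here ELABORATES; `oracle_mono`, `offTetra_iff`, `cubeOrbit_of_offTetra` are PROVED,
the rest are signatures (`sorry`) to be stubbed by a crux-plan seat.
-/

noncomputable section

open Set MeasureTheory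
open Literature.NumberTheory.Transcendental

namespace Summit.KontsevichZagierPeriods.KontsevichZagierPeriods.Cruxes.OffTetraSectorKernel.Sketch3

open Summit.KontsevichZagierPeriods.KontsevichZagierPeriods.Theses.HyperbolicBloch

/-- The standard ideal-tetrahedron family predicate, verbatim the first binder of the crux. -/
def IsStdTetraFamily (T : ℂ → Set (Fin 3 → ℝ)) : Prop :=
  ∀ z, T z = {p | 0 < p 1 ∧ z.re * p 1 < z.im * p 0 ∧ z.im * (p 0 - 1) < (z.re - 1) * p 1 ∧ 0 < p 2 ∧
    0 < z.im * (p 0 ^ 2 + p 1 ^ 2 + p 2 ^ 2 - p 0) + (z.re - Complex.normSq z) * p 1}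

/-- The tetrahedral oracle `W_T`, verbatim the adjoined closure of the crux. -/
def tetraOracle (T : ℂ → Set (Fin 3 → ℝ)) : AddSubgroup KZ.FormalRep :=
  AddSubgroup.closure {d : KZ.FormalRep | ∃ ρ : ℂ → KZ.IntegralRep 3,
    (∀ z, IsAlgebraic ℚ z → 0 < z.im → (ρ z).domain = T z ∧ Set.EqOn (ρ z).integrand (fun p => 1 / p 2 ^ 3) (T z)) ∧
    ∃ (k : ℕ) (z : Fin k → ℂ) (n : Fin k → ℤ), (∀ i, IsAlgebraic ℚ (z i)) ∧ (∀ i, 0 < (z i).im) ∧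
      ∑ i, (n i : ℝ) * (ρ (z i)).value = 0 ∧ d = ∑ i, n i • KZ.of (ρ (z i))}

/-- The crux, re-read through the two abbreviations (definitional). -/
theorem offTetra_iff :
    OffTetraSectorKernel ↔
      ∀ T, IsStdTetraFamily T → ∀ c : KZ.FormalRep, KZ.eval c = 0 → c ∈ KZ.relations ⊔ tetraOracle T :=
  Iff.rfl

/-- ORACLE MONOTONICITY (the `⊔`-shape lever, proved): a kernel theorem for any oracle `W'` that is
itself swallowed by `relations ⊔ W` gives the kernel theorem for `W`. -/
theorem oracle_mono {W W' : AddSubgroup KZ.FormalRep} (h : W' ≤ KZ.relations ⊔ W)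
    (hK : ∀ c : KZ.FormalRep, KZ.eval c = 0 → c ∈ KZ.relations ⊔ W') :
    ∀ c : KZ.FormalRep, KZ.eval c = 0 → c ∈ KZ.relations ⊔ W :=
  fun c hc => (sup_le le_sup_left h) (hK c hc)

/-! ## Card A — `value-one-cube-orbit` -/

/-- CUBE ORBIT mod W: every compact top-dimensional integrand-`1` solid of volume `1` differs from
the unit cube of its dimension by an element of `relations ⊔ W`. -/
def CubeOrbitModTetra : Prop :=
  ∀ (T : ℂ → Set (Fin 3 → ℝ)), IsStdTetraFamily T →
  ∀ (d : ℕ) (K Q : KZ.IntegralRep d), IsCompact K.domain → (interior K.domain).Nonempty →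
    (∀ x ∈ K.domain, K.integrand x = 1) → Q.domain = KZ.cube d → (∀ x ∈ Q.domain, Q.integrand x = 1) →
    K.value = 1 → KZ.of K - KZ.of Q ∈ KZ.relations ⊔ tetraOracle T

/-- CUBE DENSITY mod W: a non-negative `ℚ`-semialgebraic density of mass `1` on the unit cube is
move-equivalent (mod W) to the density `1`. -/
def CubeDensityModTetra : Prop :=
  ∀ (T : ℂ → Set (Fin 3 → ℝ)), IsStdTetraFamily T →
  ∀ (d : ℕ) (G Q : KZ.IntegralRep d), G.domain = KZ.cube d → (∀ x ∈ G.domain, 0 ≤ G.integrand x) →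
    Q.domain = KZ.cube d → (∀ x ∈ Q.domain, Q.integrand x = 1) → G.value = 1 →
    KZ.of G - KZ.of Q ∈ KZ.relations ⊔ tetraOracle T

/-- KNOTHE STAIRCASE NORMAL FORM (unconditional theorem-candidate, no primitives): every bounded
integrand-`1` solid in `ℝ^{d+1}` is KZ-equivalent to a `d`-dimensional representation on the unit
cube with non-negative semialgebraic integrand (CAD + fibrewise unimodular maps + one under-graph move). -/
def KnotheNormalForm : Prop :=
  ∀ (d : ℕ) (K : KZ.IntegralRep (d + 1)), Bornology.IsBounded K.domain →
    (∀ x ∈ K.domain, K.integrand x = 1) →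
    ∃ G : KZ.IntegralRep d, G.domain = KZ.cube d ∧ (∀ x ∈ G.domain, 0 ≤ G.integrand x) ∧ KZ.Equivalent K G

/-- DIMENSION DROP (provable now: one slab = one Newton–Leibniz instance, plus a coordinate
permutation): a cube density that omits a coordinate is equivalent to the cube density one dimension down. -/
def DimensionDrop : Prop :=
  ∀ (d : ℕ) (i : Fin (d + 1)) (G : KZ.IntegralRep (d + 1)) (G' : KZ.IntegralRep d),
    G.domain = KZ.cube (d + 1) → G'.domain = KZ.cube d →
    (∀ x ∈ G.domain, G.integrand x = G'.integrand (i.removeNth x)) → KZ.Equivalent G G'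

/-- VARIABLE ELIMINATION mod W (the open heart of the line, dimension `≥ 2`): every non-negative
cube density is move-equivalent (same cube, mod W) to one that omits some coordinate. -/
def VariableEliminationModTetra : Prop :=
  ∀ (T : ℂ → Set (Fin 3 → ℝ)), IsStdTetraFamily T →
  ∀ (d : ℕ) (G : KZ.IntegralRep (d + 2)), G.domain = KZ.cube (d + 2) → (∀ x ∈ G.domain, 0 ≤ G.integrand x) →
    ∃ (i : Fin (d + 2)) (G₁ : KZ.IntegralRep (d + 2)), G₁.domain = KZ.cube (d + 2) ∧
      (∀ x ∈ G₁.domain, 0 ≤ G₁.integrand x) ∧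
      (∀ x ∈ G₁.domain, ∀ t ∈ Set.Icc (0:ℝ) 1, G₁.integrand (Function.update x i t) = G₁.integrand x) ∧
      KZ.of G - KZ.of G₁ ∈ KZ.relations ⊔ tetraOracle T

/-- ONE-DIMENSIONAL BASE (the 1-period sector): mass-`1` non-negative semialgebraic densities on
`[0,1]` are accessible (mod W; W is not expected to be needed). -/
def OneDimDensityModTetra : Prop :=
  ∀ (T : ℂ → Set (Fin 3 → ℝ)), IsStdTetraFamily T →
  ∀ (G Q : KZ.IntegralRep 1), G.domain = KZ.cube 1 → (∀ x ∈ G.domain, 0 ≤ G.integrand x) →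
    Q.domain = KZ.cube 1 → (∀ x ∈ Q.domain, Q.integrand x = 1) → G.value = 1 →
    KZ.of G - KZ.of Q ∈ KZ.relations ⊔ tetraOracle T

/-- FIRST LEMMA of card A (transfer, both directions provable from tree theorems
`KZ.exists_integralRep_sub_holds`, `KZ.exists_sub_isBounded`, slabs, packing
`KZ.exists_isCompact_of_sub_of_sub_mem_relations`). -/
theorem firstLemmaA : CubeOrbitModTetra ↔ OffTetraSectorKernel := by
  sorry

/-- The trivial direction of `firstLemmaA`, PROVED: the crux gives the cube orbit. -/
theorem cubeOrbit_of_offTetra (h : OffTetraSectorKernel) : CubeOrbitModTetra := by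
  intro T hT d K Q _ _ hK1 hQd hQ1 hKv
  refine h T hT _ ?_
  have hQv : Q.value = 1 := by
    rw [Q.value_eq_volume_real hQ1, hQd, measureReal_def, KZ.volume_cube, ENNReal.toReal_one]
  simp [KZ.eval_of, hKv, hQv]

/-- The induction scheme of card A (pure logic over the items above; proof deferred to crux-plan). -/
theorem cubeDensity_of_elimination :
    DimensionDrop → VariableEliminationModTetra → OneDimDensityModTetra → CubeDensityModTetra := by
  sorry

/-- Card A, second transfer: Knothe normal form turns the cube orbit into the cube density. -/
theorem cubeOrbit_of_cubeDensity : KnotheNormalForm → CubeDensityModTetra → CubeOrbitModTetra := by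
  sorry

/-! ## Card B — `odd-simplex-ladder` -/

/-- INVERSION MOVE in every dimension (first lemma of card B): on the upper half-space
`{p | 0 < p last}` of `ℝ^{k+1}` the inversion `p ↦ p / ‖p‖²` carries any representation with the
hyperbolic density `t^{-(k+1)}` to an equivalent one with the same density: ONE change of variables,
`|det Dι| = ‖p‖^{-2(k+1)}` and `t ∘ ι = t/‖p‖²`. With algebraic translations and dilations it
generates every Möbius isometry of `ℍ^{k+1}` with algebraic coefficients (Liouville). -/
def InversionMove : Prop :=
  ∀ (k : ℕ) (r r' : KZ.IntegralRep (k + 1)),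
    r.domain ⊆ {p | 0 < p (Fin.last k)} →
    Set.EqOn r.integrand (fun p => 1 / p (Fin.last k) ^ (k + 1)) r.domain →
    r'.domain = (fun p : Fin (k + 1) → ℝ => (1 / ∑ i, p i ^ 2) • p) '' r.domain →
    Set.EqOn r'.integrand (fun p => 1 / p (Fin.last k) ^ (k + 1)) r'.domain →
    KZ.Equivalent r r'

/-- SIMILARITY MOVE in every dimension: algebraic dilation-plus-translation of the boundary
coordinates with the matching dilation of `t` preserves the density `t^{-(k+1)}`. -/
def SimilarityMove : Prop :=
  ∀ (k : ℕ) (a : ℝ) (b : Fin (k + 1) → ℝ), IsAlgebraic ℚ a → 0 < a → (∀ i, IsAlgebraic ℚ (b i)) →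
    b (Fin.last k) = 0 →
    ∀ (r r' : KZ.IntegralRep (k + 1)),
    r.domain ⊆ {p | 0 < p (Fin.last k)} →
    Set.EqOn r.integrand (fun p => 1 / p (Fin.last k) ^ (k + 1)) r.domain →
    r'.domain = (fun p : Fin (k + 1) → ℝ => a • p + b) '' r.domain →
    Set.EqOn r'.integrand (fun p => 1 / p (Fin.last k) ^ (k + 1)) r'.domain →
    KZ.Equivalent r r'

/-- DISSECTION LEMMA (uniform replacement for every Pachner / bistellar case analysis, provable now
by iterated domain additivity through the common refinement `{rᵢ ∩ sⱼ}`): two finite a.e.-partitions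
of a.e. the same set, carrying one common integrand, give a relation. -/
def DissectionLemma : Prop :=
  ∀ (n k l : ℕ) (r : Fin k → KZ.IntegralRep n) (s : Fin l → KZ.IntegralRep n) (f : (Fin n → ℝ) → ℝ),
    (∀ i, Set.EqOn (r i).integrand f (r i).domain) → (∀ j, Set.EqOn (s j).integrand f (s j).domain) →
    (∀ i i', i ≠ i' → volume ((r i).domain ∩ (r i').domain) = 0) →
    (∀ j j', j ≠ j' → volume ((s j).domain ∩ (s j').domain) = 0) →
    volume (symmDiff (⋃ i, (r i).domain) (⋃ j, (s j).domain)) = 0 →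
    ∑ i, KZ.of (r i) - ∑ j, KZ.of (s j) ∈ KZ.relations

/-- LADDER REDUCTION (shape of card B's composition, proved): if the value-relators of a bigger
oracle `W'` (all odd-dimensional `ℚ̄`-ideal-simplex combinations of total volume `0`) are KZ
relations — which is what the geometric transfers give from the named injectivity conjectures —
then the crux follows from the kernel statement relative to `W'`. -/
theorem ladder_reduction {T : ℂ → Set (Fin 3 → ℝ)} (W' : AddSubgroup KZ.FormalRep)
    (hW' : W' ≤ KZ.relations)
    (hK : ∀ c : KZ.FormalRep, KZ.eval c = 0 → c ∈ KZ.relations ⊔ W') :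
    ∀ c : KZ.FormalRep, KZ.eval c = 0 → c ∈ KZ.relations ⊔ tetraOracle T :=
  oracle_mono (hW'.trans le_sup_left) hK

end Summit.KontsevichZagierPeriods.KontsevichZagierPeriods.Cruxes.OffTetraSectorKernel.Sketch3
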